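import Summits.BirchSwinnertonDyer.BirchSwinnertonDyer.Theorems.UniversalToricDescentHessianTwinAtThree
import Literature.NumberTheory.EllipticCurves.BurungaleSkinner2023.RationalThreeTorsionEngineProofs
import HarnessLib

/-!
# Route `UniversalToricDescent`, crux #3 buckets A/B (items 20693 closed / 20694 `TwinSplitIMCAtThreeMult`): THE HESSIAN IS THE SEMISTABLE TWIN on the `3`-adic types with `v₃(c₆) = 6` — multiplicative for `(≥5, 6, 9)` and `(4, 6, ≥10)`, good ordinary for `(4, 6, 9)` (PROVED, unconditional)

Cell `bsd-wall` (W-ALL lane 3, row 2·3@3), seat `bsd-wall-utd-p2` g7 (LEAD, line mode; second item 20694),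
2026-08-27. `--supports stmt-BirchSwinnertonDyer-20694`. Companion of
`UniversalToricDescentHessianTwinAtThree.lean` (p583681: type `(4, ≥7)` ↦ good supersingular, `a₃ = 0`).

WHAT IS PROVED (no `sorry`, no named fact). Let `W/ℚ` be an elliptic curve with `c₄(W) = 3⁴u`,
`c₆(W) = 3⁶w`, `3 ∤ w` (`u, w ∈ ℤ`; for a globally minimal `W`: `v₃(c₄) ≥ 4`, `v₃(c₆) = 6`, and then
`v₃(Δ) = 9 + v₃(u³ − w²)`). Let `D(0:1) = Fisher2012.hessePencil3 c₄ c₆ 0 1` (the Hessian member).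
* §1 the integer model `P = [0, −4w, 0, 4w² + u³, −2u³w]` has `c₄(P) = 16(4w² − 3u³)` (a `3`-adic unit) and
  `Δ(P) = 64u⁶(w² − u³)`; §2 `⟨3⁴, −4·3⁷w, 0, 0⟩ • D(0:1) = P ⊗ ℚ` (`rescaleShift_hessePencil3_zero_one`).
* §3 `hasMultiplicativeReductionAtPrime_smul_hessePencil3_zero_one`: if `3 ∣ u⁶(w² − u³)` — i.e. `3 ∣ u`
  (types `(≥5, 6, 9)`) or `u ≡ 1 (mod 3)` (types `(4, 6, ≥10)`) — EVERY model `C • D(0:1)` has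
  MULTIPLICATIVE reduction at `3`.
* §4 `goodOrd_smul_hessePencil3_zero_one`: if `3 ∤ u` and `3 ∤ w² − u³` — i.e. `u ≡ 2 (mod 3)`, type
  `(4, 6, 9)` — every global minimal model of `D(0:1)` has GOOD ORDINARY reduction at `3` (`a₃ = ±2`).
* §5 packaging (integer form): `3`-congruent (Fisher Thm. 13.2, tree-proved), globally minimal twins
  `exists_mult_twin_of_c₄_c₆`, `exists_goodOrd_twin_of_c₄_c₆` (a global minimal model of `D(0:1)`). The
  valuation-currency corollaries (`5 ≤ v₃(c₄)`, `v₃(c₆) = 6` / `v₃(c₄) = 4`, `v₃(c₆) = 6`, `10 ≤ v₃(Δ)` ↦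
  multiplicative twin; `(4,6,9)` ↦ good ordinary twin; `v₃(c₄) ≥ 4`, `v₃(c₆) = 6`, onto ↦ on the twin cell)
  are in the companion `UniversalToricDescentHessianTwinSemistableTypesAtThree.lean`.

READING. utd-idea g9's HESSIAN LAW (LENS-MEMO v11 §6, `steer/HESSIAN-TWIN-v1.tsv`: `(4,6,9)` ↦ ordinary
`334/334`; `(4,6,10)`, `(4,6,11)`, `(k,6,9)`, `k ≥ 5` ↦ multiplicative, split type `= s(class)`, `673/673`
bucket-B classes together with `(k,4,5)`, `(6,8,13)`) becomes a THEOREM for every curve of the types with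
`v₃(c₆) = 6` (the rows `(k,4,5)` and `(6,8,13)` need another integer model and are NOT treated here; the
split/non-split sign law is not treated). Bucket B's crux (item 20694) is NOT proved or reduced by this;
what is gained is that its twin is CANONICAL (the Hessian) on these types. BSD is not proved for any curve.

HONEST FRAMING: helper theorems; nothing closes; no statement item filed (D-0014); no new definition.
References: T. Fisher, Proc. LMS (3) 104 (2012) 613–648, §8, Thm. 13.2 [Fisher2012Hessian];
J. H. Silverman, *AEC* VII.5 Prop. 5.1, Ex. 8.19(a) [SilvermanAEC2009]; memos
HOME/bsd-wall-utd-idea/LENS-MEMO-UTD-IDEA-v11.md §6, HOME/bsd-wall-utd-p2/SUPSET-AT3-v9.md.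
-/

set_option autoImplicit false
set_option linter.dupNamespace false

noncomputable section

namespace Summit.BirchSwinnertonDyer.BirchSwinnertonDyer.Theorems.UniversalToricDescentHessianTwin

open WeierstrassCurve
  Literature.NumberTheory.EllipticCurves
  Literature.NumberTheory.EllipticCurves.Rank1Residual
  Literature.NumberTheory.EllipticCurves.Fisher2012
  Literature.NumberTheory.EllipticCurves.BSZLemma17
  Literature.NumberTheory.EllipticCurves.BurungaleSkinner2023
  Literature.NumberTheory.Automorphic
  Summit.BirchSwinnertonDyer.Rank1Residual
  Summit.BirchSwinnertonDyer.BirchSwinnertonDyer.Theorems.UniversalToricDescentTwinChoice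

/-! ## §1 The integer model `P = [0, −4w, 0, 4w² + u³, −2u³w]` -/

/-- `c₄(P) = 16(4w² − 3u³)`. [folklore] -/
theorem c₄_hessianIntModelB (u w : ℤ) :
    (⟨0, -4 * w, 0, 4 * w ^ 2 + u ^ 3, -2 * u ^ 3 * w⟩ : WeierstrassCurve ℤ).c₄ = 16 * (4 * w ^ 2 - 3 * u ^ 3) := by
  simp only [WeierstrassCurve.c₄, WeierstrassCurve.b₂, WeierstrassCurve.b₄]
  ring

/-- `Δ(P) = 64u⁶(w² − u³)`. [folklore] -/
theorem Δ_hessianIntModelB (u w : ℤ) :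
    (⟨0, -4 * w, 0, 4 * w ^ 2 + u ^ 3, -2 * u ^ 3 * w⟩ : WeierstrassCurve ℤ).Δ = 64 * (u ^ 6 * (w ^ 2 - u ^ 3)) := by
  simp only [WeierstrassCurve.Δ, WeierstrassCurve.b₂, WeierstrassCurve.b₄, WeierstrassCurve.b₆,
    WeierstrassCurve.b₈]
  ring

/-- `3 ∤ c₄(P)` when `3 ∤ w` (`c₄(P) ≡ w² (mod 3)`). [folklore] -/
theorem three_not_dvd_c₄_hessianIntModelB (u w : ℤ) (hw : ¬ (3 : ℤ) ∣ w) :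
    ¬ (3 : ℤ) ∣ (⟨0, -4 * w, 0, 4 * w ^ 2 + u ^ 3, -2 * u ^ 3 * w⟩ : WeierstrassCurve ℤ).c₄ := by
  rw [c₄_hessianIntModelB]
  intro h
  apply hw
  have h3 : (((16 * (4 * w ^ 2 - 3 * u ^ 3) : ℤ)) : ZMod 3) = 0 := by
    rw [ZMod.intCast_zmod_eq_zero_iff_dvd]; exact_mod_cast h
  have hw3 : (w : ZMod 3) = 0 := by
    push_cast at h3
    generalize (u : ZMod 3) = a at h3
    generalize (w : ZMod 3) = b at h3 ⊢
    revert a b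
    decide
  rw [ZMod.intCast_zmod_eq_zero_iff_dvd] at hw3
  exact_mod_cast hw3

/-- `3 ∣ Δ(P)` when `3 ∣ u⁶(w² − u³)`. [folklore] -/
theorem three_dvd_Δ_hessianIntModelB (u w : ℤ) (h : (3 : ℤ) ∣ u ^ 6 * (w ^ 2 - u ^ 3)) :
    (3 : ℤ) ∣ (⟨0, -4 * w, 0, 4 * w ^ 2 + u ^ 3, -2 * u ^ 3 * w⟩ : WeierstrassCurve ℤ).Δ := by
  rw [Δ_hessianIntModelB]
  exact dvd_mul_of_dvd_right h 64

/-- `3 ∤ Δ(P)` when `3 ∤ u` and `3 ∤ w² − u³`. [folklore] -/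
theorem three_not_dvd_Δ_hessianIntModelB (u w : ℤ) (hu : ¬ (3 : ℤ) ∣ u) (hd : ¬ (3 : ℤ) ∣ w ^ 2 - u ^ 3) :
    ¬ (3 : ℤ) ∣ (⟨0, -4 * w, 0, 4 * w ^ 2 + u ^ 3, -2 * u ^ 3 * w⟩ : WeierstrassCurve ℤ).Δ := by
  rw [Δ_hessianIntModelB]
  intro h
  have h3 : Prime (3 : ℤ) := Int.prime_three
  rcases h3.dvd_or_dvd h with h64 | h'
  · norm_num at h64
  · rcases h3.dvd_or_dvd h' with h6 | hd'
    · exact hu (h3.dvd_of_dvd_pow h6)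
    · exact hd hd'

/-- Residues: `3 ∤ u`, `3 ∤ w`, `3 ∤ w² − u³` force `u ≡ 2 (mod 3)`. [folklore] -/
theorem intCast_eq_two_of_not_dvd (u w : ℤ) (hu : ¬ (3 : ℤ) ∣ u) (hw : ¬ (3 : ℤ) ∣ w)
    (hd : ¬ (3 : ℤ) ∣ w ^ 2 - u ^ 3) : (u : ZMod 3) = 2 := by
  have hu' : (u : ZMod 3) ≠ 0 := by
    rw [ne_eq, ZMod.intCast_zmod_eq_zero_iff_dvd]; exact_mod_cast hu
  have hw' : (w : ZMod 3) ≠ 0 := by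
    rw [ne_eq, ZMod.intCast_zmod_eq_zero_iff_dvd]; exact_mod_cast hw
  have hd' : ((w ^ 2 - u ^ 3 : ℤ) : ZMod 3) ≠ 0 := by
    rw [ne_eq, ZMod.intCast_zmod_eq_zero_iff_dvd]; exact_mod_cast hd
  push_cast at hd'
  generalize (u : ZMod 3) = a at hu' hd' ⊢
  generalize (w : ZMod 3) = b at hw' hd'
  revert a b
  decide

/-- Reduction modulo `3` of `P`. [folklore] -/
theorem map_hessianIntModelB_zmod_three (u w : ℤ) :
    (⟨0, -4 * w, 0, 4 * w ^ 2 + u ^ 3, -2 * u ^ 3 * w⟩ : WeierstrassCurve ℤ).map (Int.castRingHom (ZMod 3)) =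
      ⟨0, -4 * (w : ZMod 3), 0, 4 * (w : ZMod 3) ^ 2 + (u : ZMod 3) ^ 3,
        -2 * (u : ZMod 3) ^ 3 * (w : ZMod 3)⟩ := by
  simp [WeierstrassCurve.map]

/-- Over `𝔽₃`, `y² = x³ − 4b x² + (4b² + 8)x − 16b` (`a = 2`, `b ≠ 0`) has `2` or `6` points (kernel
decision). [folklore] -/
theorem natCard_point_hessianShapeB_zmod_three : ∀ (b : ZMod 3), b ≠ 0 →
    Nat.card (⟨0, -4 * b, 0, 4 * b ^ 2 + (2 : ZMod 3) ^ 3, -2 * (2 : ZMod 3) ^ 3 * b⟩ :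
      WeierstrassCurve (ZMod 3)).toAffine.Point = 2 ∨
    Nat.card (⟨0, -4 * b, 0, 4 * b ^ 2 + (2 : ZMod 3) ^ 3, -2 * (2 : ZMod 3) ^ 3 * b⟩ :
      WeierstrassCurve (ZMod 3)).toAffine.Point = 6 := by
  intro b hb
  fin_cases b
  · exact absurd rfl hb
  · left
    rw [natCard_point_eq_one_add_card _ (by decide +kernel)]
    decide +kernel
  · right
    rw [natCard_point_eq_one_add_card _ (by decide +kernel)]
    decide +kernel

/-- **`3 ∤ a₃(P)`** (`a₃ = ±2`, ordinary) when `3 ∤ u`, `3 ∤ w`, `3 ∤ w² − u³`. [folklore] -/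
theorem three_not_dvd_frobeniusTrace_hessianIntModelB (u w : ℤ) (hu : ¬ (3 : ℤ) ∣ u)
    (hw : ¬ (3 : ℤ) ∣ w) (hd : ¬ (3 : ℤ) ∣ w ^ 2 - u ^ 3) :
    ¬ (3 : ℤ) ∣ Literature.NumberTheory.Automorphic.frobeniusTrace
      ⟨0, -4 * w, 0, 4 * w ^ 2 + u ^ 3, -2 * u ^ 3 * w⟩ 3 := by
  have h2 := intCast_eq_two_of_not_dvd u w hu hw hd
  have hw' : (w : ZMod 3) ≠ 0 := by
    rw [ne_eq, ZMod.intCast_zmod_eq_zero_iff_dvd]; exact_mod_cast hw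
  rw [Literature.NumberTheory.Automorphic.frobeniusTrace, numPointsMod, map_hessianIntModelB_zmod_three, h2]
  rcases natCard_point_hessianShapeB_zmod_three _ hw' with h | h <;> rw [h] <;> decide

/-! ## §2 `D(0:1)` rescaled and shifted is `P ⊗ ℚ` -/

/-- **`⟨3⁴, −4·3⁷w, 0, 0⟩ • D(0:1) = P ⊗ ℚ`** for `c₄ = 3⁴u`, `c₆ = 3⁶w`: the Hesse member
`D(0:1) : y² = x³ − 27(4c₆² − 3c₄³)x − 54(9c₄³c₆ − 8c₆³)`, rescaled by `3⁴` and shifted by `r = −4·3⁷w`, is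
`[0, −4w, 0, 4w² + u³, −2u³w]`. [cite: Fisher2012Hessian, §8 (Hesse polynomials, n = 3)] -/
theorem rescaleShift_hessePencil3_zero_one (W : WeierstrassCurve ℚ) (u w : ℤ) (h4 : W.c₄ = 3 ^ 4 * u)
    (h6 : W.c₆ = 3 ^ 6 * w) :
    (⟨Units.mk0 ((3 : ℚ) ^ 4) (by norm_num), -4 * 3 ^ 7 * (w : ℚ), 0, 0⟩ : VariableChange ℚ) •
        hessePencil3 W.c₄ W.c₆ 0 1 =
      (⟨0, -4 * w, 0, 4 * w ^ 2 + u ^ 3, -2 * u ^ 3 * w⟩ : WeierstrassCurve ℤ).baseChange ℚ := by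
  rw [hessePencil3_eq, h4, h6]
  ext <;>
    simp [WeierstrassCurve.baseChange, WeierstrassCurve.map, variableChange_a₁, variableChange_a₂,
      variableChange_a₃, variableChange_a₄, variableChange_a₆, Units.val_inv_eq_inv_val, Units.val_mk0] <;>
    ring

/-! ## §3 Multiplicative Hessian: `3 ∣ u⁶(w² − u³)` -/

/-- **MULTIPLICATIVE HESSIAN.** If `c₄ = 3⁴u`, `c₆ = 3⁶w`, `3 ∤ w` and `3 ∣ u⁶(w² − u³)` — i.e. `3 ∣ u`
(types `(≥5, 6, 9)`) or `u ≡ 1 (mod 3)` (types `(4, 6, ≥10)`) — then EVERY model `C • D(0:1)` of the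
Hessian member has multiplicative reduction at `3` (`P` has unit `c₄` and `3 ∣ Δ`; reduction type is a
`ℚ`-isomorphism invariant). [folklore] -/
theorem hasMultiplicativeReductionAtPrime_smul_hessePencil3_zero_one (W : WeierstrassCurve ℚ) (u w : ℤ)
    (hw : ¬ (3 : ℤ) ∣ w) (hΔ : (3 : ℤ) ∣ u ^ 6 * (w ^ 2 - u ^ 3)) (h4 : W.c₄ = 3 ^ 4 * u)
    (h6 : W.c₆ = 3 ^ 6 * w) (C : VariableChange ℚ) [(C • hessePencil3 W.c₄ W.c₆ 0 1).IsElliptic] :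
    (C • hessePencil3 W.c₄ W.c₆ 0 1).HasMultiplicativeReductionAtPrime 3 := by
  set M := C • hessePencil3 W.c₄ W.c₆ 0 1 with hM
  set C₁ : VariableChange ℚ := ⟨Units.mk0 ((3 : ℚ) ^ 4) (by norm_num), -4 * 3 ^ 7 * (w : ℚ), 0, 0⟩
    with hC₁
  have hkey : (C₁ * C⁻¹) • M =
      (⟨0, -4 * w, 0, 4 * w ^ 2 + u ^ 3, -2 * u ^ 3 * w⟩ : WeierstrassCurve ℤ).baseChange ℚ := by
    rw [hM, mul_smul, inv_smul_smul]
    exact rescaleShift_hessePencil3_zero_one W u w h4 h6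
  haveI : ((⟨0, -4 * w, 0, 4 * w ^ 2 + u ^ 3, -2 * u ^ 3 * w⟩ : WeierstrassCurve ℤ).baseChange ℚ).IsElliptic := by
    rw [← hkey]; infer_instance
  rw [← BSZLemma17.hasMultiplicativeReductionAtPrime_smul_iff M (C₁ * C⁻¹) 3, hkey]
  exact hasMultiplicativeReductionAtPrime_baseChange_int_of_dvd_of_not_dvd _
    (three_dvd_Δ_hessianIntModelB u w hΔ) (three_not_dvd_c₄_hessianIntModelB u w hw)

/-! ## §4 Good ordinary Hessian: `3 ∤ u`, `3 ∤ w² − u³` -/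

/-- **GOOD ORDINARY HESSIAN.** If `c₄ = 3⁴u`, `c₆ = 3⁶w`, `3 ∤ u`, `3 ∤ w`, `3 ∤ w² − u³` (type `(4, 6, 9)`:
`u ≡ 2 (mod 3)`), then every global minimal model of `D(0:1)` has good reduction at `3` with `3 ∤ a₃`
(`GoodOrd · 3`; in fact `a₃ = ±2`). [folklore] -/
theorem goodOrd_smul_hessePencil3_zero_one (W : WeierstrassCurve ℚ) (u w : ℤ)
    (hu : ¬ (3 : ℤ) ∣ u) (hw : ¬ (3 : ℤ) ∣ w) (hd : ¬ (3 : ℤ) ∣ w ^ 2 - u ^ 3)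
    (h4 : W.c₄ = 3 ^ 4 * u) (h6 : W.c₆ = 3 ^ 6 * w) (C : VariableChange ℚ)
    [(C • hessePencil3 W.c₄ W.c₆ 0 1).IsElliptic] [(C • hessePencil3 W.c₄ W.c₆ 0 1).IsGloballyMinimal] :
    GoodOrd (C • hessePencil3 W.c₄ W.c₆ 0 1) 3 := by
  set M := C • hessePencil3 W.c₄ W.c₆ 0 1 with hM
  set P : WeierstrassCurve ℤ := ⟨0, -4 * w, 0, 4 * w ^ 2 + u ^ 3, -2 * u ^ 3 * w⟩ with hP
  set C₁ : VariableChange ℚ := ⟨Units.mk0 ((3 : ℚ) ^ 4) (by norm_num), -4 * 3 ^ 7 * (w : ℚ), 0, 0⟩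
    with hC₁
  have hkey : (C₁ * C⁻¹) • M = P.baseChange ℚ := by
    rw [hM, mul_smul, inv_smul_smul]
    exact rescaleShift_hessePencil3_zero_one W u w h4 h6
  haveI hPe : (P.baseChange ℚ).IsElliptic := by rw [← hkey]; infer_instance
  have hΔ : ¬ (3 : ℤ) ∣ P.Δ := three_not_dvd_Δ_hessianIntModelB u w hu hd
  have hgoodP : (P.baseChange ℚ).HasGoodReductionAtPrime 3 :=
    hasGoodReductionAtPrime_baseChange_int_of_not_dvd P hΔ
  have hgood : M.HasGoodReductionAtPrime 3 := by
    rw [← BSZLemma17.hasGoodReductionAtPrime_smul_iff M (C₁ * C⁻¹) 3, hkey]; exact hgoodP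
  refine ⟨hgood, ?_⟩
  rw [← LFunction_apply_prime_eq_frobeniusTrace M 3 hgood, ← LFunction_smul M (C₁ * C⁻¹), hkey,
    WeierstrassCurve.baseChange, algebraMap_int_eq, lFunction_map_apply_prime_of_not_dvd P Nat.prime_three hΔ]
  exact three_not_dvd_frobeniusTrace_hessianIntModelB u w hu hw hd

/-! ## §5 Packaging: named semistable twins on the types with `v₃(c₆) = 6` -/

/-- `c₄ ≠ 0` or the degenerate case: if `c₄ = 3⁴u` with `u = 0` the member `D(0:1)` may be singular; we
only need `c₄ ≠ 0 ∨ c₆ ≠ 0`-type non-degeneracy through `W.IsElliptic` and `c₄ ≠ 0`. Here: `3 ∤ w` and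
`c₆ = 3⁶ w` give `c₆ ≠ 0`, and `𝔇(0,1) = −3c₄²` needs `c₄ ≠ 0`; for `u = 0` (`c₄ = 0`, `j = 0`) the member
`D(0:1)` IS singular, so the packaging below assumes `u ≠ 0` where needed via `3 ∣ u⁶(w²−u³)` only in the
form used. [folklore] -/
theorem c₄_ne_zero_of_eq (W : WeierstrassCurve ℚ) (u : ℤ) (hu0 : u ≠ 0) (h4 : W.c₄ = 3 ^ 4 * u) :
    W.c₄ ≠ 0 := by
  rw [h4]
  exact mul_ne_zero (by norm_num) (by exact_mod_cast hu0)

/-- **MULTIPLICATIVE TWIN, NAMED (integer form).** `c₄ = 3⁴u`, `u ≠ 0`, `c₆ = 3⁶w`, `3 ∤ w`,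
`3 ∣ u⁶(w² − u³)` ⟹ `W` has a globally minimal `3`-congruent twin with multiplicative reduction at `3`
(a global minimal model of its Hessian member `D(0:1)`). [folklore] -/
theorem exists_mult_twin_of_c₄_c₆ (W : WeierstrassCurve ℚ) [W.IsElliptic] (u w : ℤ) (hu0 : u ≠ 0)
    (hw : ¬ (3 : ℤ) ∣ w) (hΔ : (3 : ℤ) ∣ u ^ 6 * (w ^ 2 - u ^ 3)) (h4 : W.c₄ = 3 ^ 4 * u)
    (h6 : W.c₆ = 3 ^ 6 * w) :
    ∃ (W' : WeierstrassCurve ℚ) (_ : W'.IsElliptic) (_ : W'.IsGloballyMinimal),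
      O6.ModPCongruent W' W 3 ∧ Mult W' 3 := by
  have hc4 := c₄_ne_zero_of_eq W u hu0 h4
  haveI := isElliptic_hessePencil3_zero_one W hc4
  obtain ⟨C, hC⟩ := WeierstrassCurve.hasGlobalMinimalModel_rat_holds (hessePencil3 W.c₄ W.c₆ 0 1)
  haveI := hC
  exact ⟨C • hessePencil3 W.c₄ W.c₆ 0 1, inferInstance, hC, modPCongruent_smul_hessePencil3_zero_one W hc4 C,
    hasMultiplicativeReductionAtPrime_smul_hessePencil3_zero_one W u w hw hΔ h4 h6 C⟩

/-- **GOOD ORDINARY TWIN, NAMED (integer form).** `c₄ = 3⁴u`, `c₆ = 3⁶w`, `3 ∤ u`, `3 ∤ w`, `3 ∤ w² − u³`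
⟹ `W` has a globally minimal `3`-congruent twin with good ordinary reduction at `3` (a global minimal model
of `D(0:1)`). [folklore] -/
theorem exists_goodOrd_twin_of_c₄_c₆ (W : WeierstrassCurve ℚ) [W.IsElliptic] (u w : ℤ)
    (hu : ¬ (3 : ℤ) ∣ u) (hw : ¬ (3 : ℤ) ∣ w) (hd : ¬ (3 : ℤ) ∣ w ^ 2 - u ^ 3)
    (h4 : W.c₄ = 3 ^ 4 * u) (h6 : W.c₆ = 3 ^ 6 * w) :
    ∃ (W' : WeierstrassCurve ℚ) (_ : W'.IsElliptic) (_ : W'.IsGloballyMinimal),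
      O6.ModPCongruent W' W 3 ∧ GoodOrd W' 3 := by
  have hu0 : u ≠ 0 := by rintro rfl; exact hu (dvd_zero 3)
  have hc4 := c₄_ne_zero_of_eq W u hu0 h4
  haveI := isElliptic_hessePencil3_zero_one W hc4
  obtain ⟨C, hC⟩ := WeierstrassCurve.hasGlobalMinimalModel_rat_holds (hessePencil3 W.c₄ W.c₆ 0 1)
  haveI := hC
  exact ⟨C • hessePencil3 W.c₄ W.c₆ 0 1, inferInstance, hC, modPCongruent_smul_hessePencil3_zero_one W hc4 C,
    goodOrd_smul_hessePencil3_zero_one W u w hu hw hd h4 h6 C⟩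

end Summit.BirchSwinnertonDyer.BirchSwinnertonDyer.Theorems.UniversalToricDescentHessianTwin

end
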